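import Mathlib.Analysis.SpecialFunctions.Log.Base
import Literature.Barriers.MatrixMultiplication.IrreversibilityBarrierThm9
import Literature.Barriers.MatrixMultiplication.IrreversibilityBarrierGaugeBounds
import Literature.Computability.AlgebraicComplexity.LaserSymmetrization
import Literature.Computability.AlgebraicComplexity.OneOneOneCertificate
import Literature.Computability.AlgebraicComplexity.ApproxDecompositionCertificate
import Literature.LinearAlgebra.Matrix.IntRowCertificateUnitPivot
import HarnessLib

/-!
# Irreversibility floors `2·i(sym t) ≥ c/d` by kernel-checked certificates (CVZ Prop. 17 / Thm. 9)

Topic `Literature/Barriers/MatrixMultiplication`; a companion of the catalogue entry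
`IrreversibilityBarrier` (Christandl–Vrana–Zuiddam, Theory of Computing 17 (2021), art. 2 =
arXiv:1812.06952, arXiv numbering) and of `IrreversibilityBarrierGaugeBounds.lean`, which PROVES the
two one-sided bounds of CVZ Prop. 17 for the tree's infimum formalisation of the relative exponents:
`log₂ ζ⁽¹⁾(s) ≤ ω(⟨2⟩, s)` (flattening rank) and `1/log₂(1/θ) ≤ ω(s, ⟨2⟩)` (a weight / support-functional
certificate `w₁ ⊗ w₂ ⊗ w₃ ≥ θ³` on the support).  This file packages them into ONE Boolean certificate
check for an explicit integer tensor `T ∈ ℤ^{n₁ × n₂ × n₃}` and its CYCLIC SYMMETRISATION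
`s = sym T = T ⊗ (123)·T ⊗ (123)²·T` (`symm3`, `LaserSymmetrization.lean`) — the carrier through which
every square `τ`-theorem / laser-method ending via a fixed `T` factors (CVZ Cor. 11, Rem. 12):

* `IrrFloorCert.Cert` / `IrrFloorCert.check` — the certificate (integer weight numerators `u₁, u₂, u₃`
  with common denominator `U` and a support floor `M ≤ u₁(i) u₂(j) u₃(l)` on `supp T`; three
  unit-pivot integer row certificates (`IntRowCertificateUnitPivot.lean`) for the three flattening
  ranks `F₁, F₂, F₃` of `T`; a coordinate copy of `⟨2⟩` inside `sym T`; a rational `c/d` with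
  `U^{3c} ≤ (F₁F₂F₃)^{2d} · M^c`) and its closed Boolean test, evaluated by `decide`;
* `IrrFloorCert.logFloor_of_check` — **`2 log₂(F₁F₂F₃) / log₂(U³/M) ≤ 2·i(sym T)`** over EVERY field
  (`ζ⁽¹⁾(sym T) = ζ⁽¹⁾(T) ζ⁽²⁾(T) ζ⁽³⁾(T) ≥ F₁F₂F₃` by `flatteningRank_kronecker`; the product weights
  `w(i,j',l'') = u₁(i)u₂(j')u₃(l'')/U³` certify `Q̃(sym T) ≤ U³/M`);
* `IrrFloorCert.floor_of_check` — the rational form **`c/d ≤ 2·i(sym T)`**, and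
  `IrrFloorCert.barrier_of_check` — **`c/d ≤ ω(⟨2⟩, sym T) · ω(sym T, ⟨2,2,2⟩)`**, i.e. no bound
  `ω < c/d` can be obtained through restrictions from powers of `sym T` (CVZ Thm. 9,
  `CVZ2021_thm9_holds`);
* a worked example, Strassen's tensor `Str_2` (`floor = log₂ 18 = 2·log₂ 18 / log₂ 16 ≥ 2.0849`).

The table of floors for the small laser-method carriers (`W`, `k[x]/(x^k)`, `Str_q`, `CW_q`, `cw_q`)
is the sibling file `IrreversibilityFloorSmallFormats.lean`.  HONEST FRAMING: these are kernel-checked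
CERTIFICATES of known-type barrier values (decidable verdicts on explicit small tensors), not progress
on `ω`; a floor `> 2` says only that the laser method THROUGH THAT FIXED TENSOR cannot reach `ω = 2`.

## References

* M. Christandl, P. Vrana, J. Zuiddam, *Barriers for fast matrix multiplication from
  irreversibility*, ToC 17 (2021), art. 2 = arXiv:1812.06952: §2.3 (Def. of `i(t)`), Thm. 9,
  Cor. 11 / Rem. 12 (cyclic symmetrisation), §4.1 Prop. 17, §4.2. [ChristandlVranaZuiddam2021]
* V. Strassen, J. reine angew. Math. 413 (1991), 127–180 — upper support functionals (via CVZ §4.2).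
-/

open scoped BigOperators

namespace Literature.Barriers.MatrixMultiplication

open Literature.Computability.AlgebraicComplexity Literature.LinearAlgebra.Matrix Module Submodule

universe u

/-! ## Two flattening-rank lemmas -/

section FlatteningLemmas

variable {K : Type u} [Field K]
variable {ι κ μ : Type*} [Fintype ι] [Fintype κ] [Fintype μ]

/-- The flattening rank is the rank of the flattening matrix `slab₁ t` (rows = slices).
[cite: ChristandlVranaZuiddam2021, §4.1] -/
theorem flatteningRank_eq_rank_slab₁ (t : ι → κ → μ → K) : flatteningRank t = (slab₁ t).rank := by
  rw [Matrix.rank_eq_finrank_span_row]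
  rfl

omit [Fintype ι] [Fintype κ] [Fintype μ] in
/-- A triad has flattening rank `≤ 1` (all slices are multiples of `u ⊗ v`). [folklore] -/
theorem flatteningRank_triad_le_one (w : ι → K) (u : κ → K) (v : μ → K) :
    flatteningRank (triad w u v) ≤ 1 := by
  classical
  let m : κ × μ → K := fun p => u p.1 * v p.2
  have hle : span K (Set.range (xSlices (triad w u v))) ≤ span K {m} := by
    rw [Submodule.span_le]
    rintro _ ⟨a, rfl⟩
    have e : xSlices (triad w u v) a = w a • m := by
      funext p
      simp [xSlices_apply, triad_apply, m, mul_assoc]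
    rw [e]
    exact Submodule.smul_mem _ _ (Submodule.subset_span (Set.mem_singleton m))
  calc flatteningRank (triad w u v) = finrank K (span K (Set.range (xSlices (triad w u v)))) := rfl
    _ ≤ finrank K (span K ({m} : Set (κ × μ → K))) := Submodule.finrank_mono hle
    _ ≤ ({m} : Set (κ × μ → K)).toFinset.card := finrank_span_le_card _
    _ = 1 := by simp

/-- **`ζ⁽¹⁾(sym t) = ζ⁽¹⁾(t) · ζ⁽¹⁾((123)·t) · ζ⁽¹⁾((123)²·t)`** — the first flattening rank of the cyclic
symmetrisation is the product of the three flattening ranks of `t`.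
[cite: ChristandlVranaZuiddam2021, §4.2] -/
theorem flatteningRank_symm3 (t : ι → κ → μ → K) :
    flatteningRank (symm3 t) =
      flatteningRank t * (flatteningRank (rotate t) * flatteningRank (rotate (rotate t))) := by
  show flatteningRank (kroneckerTensor t (kroneckerTensor (rotate t) (rotate (rotate t)))) = _
  rw [flatteningRank_kronecker, flatteningRank_kronecker]

end FlatteningLemmas

namespace IrrFloorCert

/-! ## The certificate and its Boolean check -/

/-- Decode a column code `c < q·r` of a flattening as the pair `(c / r, c % r)`. [folklore] -/
def colCode (q r : ℕ) [NeZero q] [NeZero r] (c : ℕ) : Fin q × Fin r := (finCode q (c / r), finCode r c)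

/-- Decode a point code `(a, b, c)` as a point of `Fin p × Fin q × Fin r`. [folklore] -/
def ptCode (p q r : ℕ) [NeZero p] [NeZero q] [NeZero r] (x : ℕ × ℕ × ℕ) : Fin p × Fin q × Fin r :=
  (finCode p x.1, finCode q x.2.1, finCode r x.2.2)

/-- An irreversibility-floor certificate for an integer tensor `T ∈ ℤ^{n₁ × n₂ × n₃}`:
weight numerators `u₁, u₂, u₃` (entry `a` is `uᵢ.getD a 0`) over the common denominator `U`, a
support floor `M`; claimed flattening ranks `F₁, F₂, F₃` with unit-pivot integer row certificates
`(rowsᵢ, pivᵢ)` for `slab₁ T`, `slab₁ ((123)·T)`, `slab₁ ((123)²·T)`; two points `x₀, x₁ / y₀, y₁ /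
z₀, z₁` of the three index sets of `sym T` (as code triples) spanning a coordinate copy of `⟨2⟩`.
[cite: ChristandlVranaZuiddam2021, Prop. 17] -/
structure Cert where
  /-- weight numerators on `Fin n₁`, `Fin n₂`, `Fin n₃` -/
  (u₁ u₂ u₃ : List ℕ)
  /-- common denominator and support floor: `M ≤ u₁ i · u₂ j · u₃ l` on `supp T` -/
  (U M : ℕ)
  /-- certified flattening ranks -/
  (F₁ F₂ F₃ : ℕ)
  /-- unit-pivot row certificates for the three flattenings -/
  (rows₁ : List (List (ℕ × ℤ))) (piv₁ : List ℕ)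
  (rows₂ : List (List (ℕ × ℤ))) (piv₂ : List ℕ)
  (rows₃ : List (List (ℕ × ℤ))) (piv₃ : List ℕ)
  /-- the coordinate copy of `⟨2⟩` in `sym T` -/
  (x₀ x₁ y₀ y₁ z₀ z₁ : ℕ × ℕ × ℕ)

variable {n₁ n₂ n₃ : ℕ} [NeZero n₁] [NeZero n₂] [NeZero n₃]

/-- The `Fin 2`-indexed box maps of a certificate. [folklore] -/
def bx (C : Cert) (a : Fin 2) : Fin n₁ × Fin n₂ × Fin n₃ := ptCode n₁ n₂ n₃ (if a = 0 then C.x₀ else C.x₁)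
/-- See `bx`. [folklore] -/
def bY (C : Cert) (b : Fin 2) : Fin n₂ × Fin n₃ × Fin n₁ := ptCode n₂ n₃ n₁ (if b = 0 then C.y₀ else C.y₁)
/-- See `bx`. [folklore] -/
def bz (C : Cert) (c : Fin 2) : Fin n₃ × Fin n₁ × Fin n₂ := ptCode n₃ n₁ n₂ (if c = 0 then C.z₀ else C.z₁)

/-- **The Boolean certificate check** for `T` and the rational floor `c/d`: (1) `∑ uᵢ ≤ U` on each
index set; (2) `0 < M < U³`; (3) `M ≤ u₁(i) u₂(j) u₃(l)` whenever `T i j l ≠ 0`; (4) the three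
unit-pivot flattening certificates; (5) `(sym T)(x_a, y_b, z_c) = [a = b = c]` on the box;
(6) `2 ≤ F₁F₂F₃`, `0 < d` and `U^{3c} ≤ (F₁F₂F₃)^{2d} · M^c` (i.e. `c/d ≤ 2 log₂(F₁F₂F₃)/log₂(U³/M)`).
[cite: ChristandlVranaZuiddam2021, Prop. 17] -/
def check (T : Fin n₁ → Fin n₂ → Fin n₃ → ℤ) (C : Cert) (c d : ℕ) : Bool :=
  decide (((List.finRange n₁).map fun a => C.u₁.getD a.val 0).sum ≤ C.U) &&
  decide (((List.finRange n₂).map fun a => C.u₂.getD a.val 0).sum ≤ C.U) &&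
  decide (((List.finRange n₃).map fun a => C.u₃.getD a.val 0).sum ≤ C.U) &&
  decide (0 < C.M) && decide (C.M < C.U ^ 3) &&
  ((List.finRange n₁).all fun i => (List.finRange n₂).all fun j => (List.finRange n₃).all fun l =>
    (T i j l == 0) || decide (C.M ≤ C.u₁.getD i.val 0 * C.u₂.getD j.val 0 * C.u₃.getD l.val 0)) &&
  intTriCheckUnit C.F₁ (fun r q => slab₁ T (finCode n₁ r) (colCode n₂ n₃ q)) C.rows₁ C.piv₁ &&
  intTriCheckUnit C.F₂ (fun r q => slab₁ (rotate T) (finCode n₂ r) (colCode n₃ n₁ q)) C.rows₂ C.piv₂ &&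
  intTriCheckUnit C.F₃ (fun r q => slab₁ (rotate (rotate T)) (finCode n₃ r) (colCode n₁ n₂ q))
    C.rows₃ C.piv₃ &&
  ((List.finRange 2).all fun a => (List.finRange 2).all fun b => (List.finRange 2).all fun e =>
    symm3 T (bx C a) (bY C b) (bz C e) == (if a = b ∧ b = e then 1 else 0)) &&
  decide (2 ≤ C.F₁ * C.F₂ * C.F₃) && decide (0 < d) &&
  decide (C.U ^ (3 * c) ≤ (C.F₁ * C.F₂ * C.F₃) ^ (2 * d) * C.M ^ c)

/-! ## What a successful check says -/

section Spec

variable {T : Fin n₁ → Fin n₂ → Fin n₃ → ℤ} {C : Cert} {c d : ℕ}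

/-- Unpacking of `check = true` into its thirteen clauses. [folklore] -/
theorem check_spec (h : check T C c d = true) :
    (∑ a : Fin n₁, C.u₁.getD a.val 0 ≤ C.U) ∧ (∑ a : Fin n₂, C.u₂.getD a.val 0 ≤ C.U) ∧
    (∑ a : Fin n₃, C.u₃.getD a.val 0 ≤ C.U) ∧ 0 < C.M ∧ C.M < C.U ^ 3 ∧
    (∀ i j l, T i j l ≠ 0 → C.M ≤ C.u₁.getD i.val 0 * C.u₂.getD j.val 0 * C.u₃.getD l.val 0) ∧
    intTriCheckUnit C.F₁ (fun r q => slab₁ T (finCode n₁ r) (colCode n₂ n₃ q)) C.rows₁ C.piv₁ = true ∧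
    intTriCheckUnit C.F₂ (fun r q => slab₁ (rotate T) (finCode n₂ r) (colCode n₃ n₁ q))
      C.rows₂ C.piv₂ = true ∧
    intTriCheckUnit C.F₃ (fun r q => slab₁ (rotate (rotate T)) (finCode n₃ r) (colCode n₁ n₂ q))
      C.rows₃ C.piv₃ = true ∧
    (∀ a b e : Fin 2, symm3 T (bx C a) (bY C b) (bz C e) = if a = b ∧ b = e then 1 else 0) ∧
    2 ≤ C.F₁ * C.F₂ * C.F₃ ∧ 0 < d ∧ C.U ^ (3 * c) ≤ (C.F₁ * C.F₂ * C.F₃) ^ (2 * d) * C.M ^ c := by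
  unfold check at h
  simp only [Bool.and_eq_true, decide_eq_true_eq] at h
  obtain ⟨⟨⟨⟨⟨⟨⟨⟨⟨⟨⟨⟨h1, h2⟩, h3⟩, h4⟩, h5⟩, h6⟩, h7⟩, h8⟩, h9⟩, h10⟩, h11⟩, h12⟩, h13⟩ := h
  refine ⟨?_, ?_, ?_, h4, h5, ?_, h7, h8, h9, ?_, h11, h12, h13⟩
  · rw [Fin.sum_univ_def]; exact h1
  · rw [Fin.sum_univ_def]; exact h2
  · rw [Fin.sum_univ_def]; exact h3
  · intro i j l hT
    rw [List.all_eq_true] at h6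
    have hi := h6 i (List.mem_finRange i)
    rw [List.all_eq_true] at hi
    have hj := hi j (List.mem_finRange j)
    rw [List.all_eq_true] at hj
    have hl := hj l (List.mem_finRange l)
    rw [Bool.or_eq_true, beq_iff_eq, decide_eq_true_eq] at hl
    exact hl.resolve_left hT
  · intro a b e
    rw [List.all_eq_true] at h10
    have ha := h10 a (List.mem_finRange a)
    rw [List.all_eq_true] at ha
    have hb := ha b (List.mem_finRange b)
    rw [List.all_eq_true] at hb
    have he := hb e (List.mem_finRange e)
    exact beq_iff_eq.1 he

end Spec

/-! ## Soundness -/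

section Sound

variable (K : Type) [Field K]

/-- The tensor `T` read in the field `K`. [folklore] -/
def cast (T : Fin n₁ → Fin n₂ → Fin n₃ → ℤ) : Fin n₁ → Fin n₂ → Fin n₃ → K := fun i j l => (T i j l : K)

variable {K}

/-- A unit-pivot row certificate of the integer flattening bounds the flattening rank of `T` over
every field. [folklore] -/
theorem le_flatteningRank_of_cert {p q r : ℕ} [NeZero p] [NeZero q] [NeZero r]
    (T : Fin p → Fin q → Fin r → ℤ) {F : ℕ} {rows : List (List (ℕ × ℤ))} {piv : List ℕ}
    (h : intTriCheckUnit F (fun a b => slab₁ T (finCode p a) (colCode q r b)) rows piv = true) :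
    F ≤ flatteningRank (cast K T) := by
  have key := le_rank_of_intTriCheckUnit (F := K) (slab₁ T) (finCode p) (colCode q r) h
  have e : (slab₁ T).map (Int.cast : ℤ → K) = slab₁ (cast K T) := rfl
  rw [flatteningRank_eq_rank_slab₁, ← e]
  exact key

omit [NeZero n₁] [NeZero n₂] [NeZero n₃] in
/-- `sym T` read in `K` is `sym` of `T` read in `K`. [folklore] -/
theorem cast_symm3 (T : Fin n₁ → Fin n₂ → Fin n₃ → ℤ) :
    (fun x y z => ((symm3 T x y z : ℤ) : K)) = symm3 (cast K T) := by
  funext x y z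
  rw [symm3_apply, symm3_apply]
  push_cast
  rfl

/-- A coordinate box of `sym T` carrying the pattern of `⟨2⟩` gives `sym T ≥ ⟨2⟩` over every field.
[cite: ChristandlVranaZuiddam2021, §4.2] -/
theorem restrictsTo_unitTensor_of_box (T : Fin n₁ → Fin n₂ → Fin n₃ → ℤ) (C : Cert)
    (hbox : ∀ a b e : Fin 2, symm3 T (bx C a) (bY C b) (bz C e) = if a = b ∧ b = e then 1 else 0) :
    TensorRestrictsTo (symm3 (cast K T)) (unitTensor K 2) := by
  classical
  have key : unitTensor K 2 =
      fun a b e => symm3 (cast K T) (bx C a) (bY C b) (bz C e) := by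
    funext a b e
    have h1 := congrFun (congrFun (congrFun (cast_symm3 (K := K) T) (bx C a)) (bY C b)) (bz C e)
    rw [← h1, hbox a b e, unitTensor_apply]
    split_ifs <;> simp
  rw [key]
  exact tensorRestrictsTo_precomp _ _ _ _

/-- **The flattening half**: `log₂(F₁F₂F₃) ≤ ω(⟨2⟩, sym T)`. [cite: ChristandlVranaZuiddam2021, Prop. 17] -/
theorem logb_le_relativeExponent_unit_symm3 (T : Fin n₁ → Fin n₂ → Fin n₃ → ℤ) (C : Cert) {c d : ℕ}
    (h : check T C c d = true) :
    Real.logb 2 ((C.F₁ * C.F₂ * C.F₃ : ℕ) : ℝ) ≤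
      relativeExponent (unitTensor K 2) (symm3 (cast K T)) := by
  obtain ⟨-, -, -, -, -, -, h7, h8, h9, -, h11, -, -⟩ := check_spec h
  have hF : C.F₁ * C.F₂ * C.F₃ ≤ flatteningRank (symm3 (cast K T)) := by
    rw [flatteningRank_symm3, Nat.mul_assoc]
    exact Nat.mul_le_mul (le_flatteningRank_of_cert T h7)
      (Nat.mul_le_mul (le_flatteningRank_of_cert (rotate T) h8)
        (le_flatteningRank_of_cert (rotate (rotate T)) h9))
  refine le_trans ?_ (logb_flatteningRank_le_relativeExponent _)
  have hpos : (0 : ℝ) < ((C.F₁ * C.F₂ * C.F₃ : ℕ) : ℝ) := by exact_mod_cast (by omega)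
  exact Real.logb_le_logb_of_le one_lt_two hpos (by exact_mod_cast hF)

/-- The normalised weight `u[a] / U`. [folklore] -/
noncomputable def wt (u : List ℕ) (U : ℕ) (a : ℕ) : ℝ := (u.getD a 0 : ℝ) / U

/-- Weights are non-negative. [folklore] -/
theorem wt_nonneg (u : List ℕ) (U a : ℕ) : 0 ≤ wt u U a := by
  unfold wt; positivity

/-- Total mass `≤ 1` from the integer inequality `∑ u[a] ≤ U`. [folklore] -/
theorem sum_wt_le_one {n : ℕ} (u : List ℕ) {U : ℕ} (hU : 0 < U)
    (h : ∑ a : Fin n, u.getD a.val 0 ≤ U) : ∑ a : Fin n, wt u U a.val ≤ 1 := by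
  have hU' : (0 : ℝ) < U := by exact_mod_cast hU
  have e : ∑ a : Fin n, wt u U a.val = (∑ a : Fin n, (u.getD a.val 0 : ℝ)) / U := by
    simp only [wt, Finset.sum_div]
  rw [e, div_le_one hU']
  exact_mod_cast h

/-- One block of the support floor: `M ≤ u₁[i] u₂[j] u₃[l]` gives `M/U³ ≤ (u₁[i]/U)(u₂[j]/U)(u₃[l]/U)`.
[folklore] -/
theorem block_le {u₁ u₂ u₃ : List ℕ} {U M i j l : ℕ} (hU : 0 < U)
    (h : M ≤ u₁.getD i 0 * u₂.getD j 0 * u₃.getD l 0) :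
    (M : ℝ) / (U : ℝ) ^ 3 ≤ wt u₁ U i * wt u₂ U j * wt u₃ U l := by
  have hU' : (0 : ℝ) < U := by exact_mod_cast hU
  have e : wt u₁ U i * wt u₂ U j * wt u₃ U l =
      ((u₁.getD i 0 * u₂.getD j 0 * u₃.getD l 0 : ℕ) : ℝ) / (U : ℝ) ^ 3 := by
    unfold wt; push_cast
    rw [div_mul_div_comm, div_mul_div_comm]; ring
  rw [e]
  exact div_le_div_of_nonneg_right (by exact_mod_cast h) (by positivity)

/-- Product weights on a triple product: non-negative with total mass `≤ 1`. [folklore] -/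
theorem prod3_weights {α β γ : Type} [Fintype α] [Fintype β] [Fintype γ] (f : α → ℝ) (g : β → ℝ)
    (k : γ → ℝ) (hf : ∀ a, 0 ≤ f a) (hg : ∀ b, 0 ≤ g b) (hk : ∀ e, 0 ≤ k e) (hf1 : ∑ a, f a ≤ 1)
    (hg1 : ∑ b, g b ≤ 1) (hk1 : ∑ e, k e ≤ 1) :
    (∀ x : α × β × γ, 0 ≤ f x.1 * (g x.2.1 * k x.2.2)) ∧
      ∑ x : α × β × γ, f x.1 * (g x.2.1 * k x.2.2) ≤ 1 := by
  refine ⟨fun x => mul_nonneg (hf _) (mul_nonneg (hg _) (hk _)), ?_⟩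
  have e : ∑ x : α × β × γ, f x.1 * (g x.2.1 * k x.2.2) = (∑ a, f a) * ((∑ b, g b) * ∑ e, k e) := by
    calc ∑ x : α × β × γ, f x.1 * (g x.2.1 * k x.2.2)
        = ∑ a, ∑ bc : β × γ, f a * (g bc.1 * k bc.2) := by rw [Fintype.sum_prod_type]
      _ = ∑ a, f a * ∑ bc : β × γ, (g bc.1 * k bc.2) := by simp_rw [Finset.mul_sum]
      _ = (∑ a, f a) * ∑ bc : β × γ, (g bc.1 * k bc.2) := by rw [Finset.sum_mul]
      _ = (∑ a, f a) * ((∑ b, g b) * ∑ e, k e) := by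
          congr 1
          rw [Finset.sum_mul_sum, Fintype.sum_prod_type]
  rw [e]
  have hg0 : 0 ≤ ∑ b, g b := Finset.sum_nonneg fun b _ => hg b
  have hk0 : 0 ≤ ∑ e, k e := Finset.sum_nonneg fun e _ => hk e
  exact mul_le_one₀ hf1 (mul_nonneg hg0 hk0) (mul_le_one₀ hg1 hk0 hk1)

/-- **The support-functional half**: `1 / log₂(U³/M) ≤ ω(sym T, ⟨2⟩)` (product weights
`u₁(i)u₂(j')u₃(l'')/U³` on the three index sets of `sym T`, floor `θ³ = (M/U³)³` on its support).
[cite: ChristandlVranaZuiddam2021, Prop. 17] -/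
theorem inv_logb_le_relativeExponent_symm3_unit (T : Fin n₁ → Fin n₂ → Fin n₃ → ℤ) (C : Cert)
    {c d : ℕ} (h : check T C c d = true) :
    1 / Real.logb 2 ((C.U : ℝ) ^ 3 / C.M) ≤
      relativeExponent (symm3 (cast K T)) (unitTensor K 2) := by
  classical
  obtain ⟨h1, h2, h3, h4, h5, h6, -, -, -, h10, -, -, -⟩ := check_spec h
  have hUpos : 0 < C.U := by
    rcases Nat.eq_zero_or_pos C.U with h0 | hp
    · rw [h0] at h5; simp at h5
    · exact hp
  have hM : (0 : ℝ) < C.M := by exact_mod_cast h4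
  have hU3 : (0 : ℝ) < (C.U : ℝ) ^ 3 := by positivity
  obtain ⟨hw₁0, hw₁1⟩ := prod3_weights (fun a : Fin n₁ => wt C.u₁ C.U a.val)
    (fun a : Fin n₂ => wt C.u₂ C.U a.val) (fun a : Fin n₃ => wt C.u₃ C.U a.val)
    (fun a => wt_nonneg _ _ _) (fun a => wt_nonneg _ _ _) (fun a => wt_nonneg _ _ _)
    (sum_wt_le_one C.u₁ hUpos h1) (sum_wt_le_one C.u₂ hUpos h2) (sum_wt_le_one C.u₃ hUpos h3)
  obtain ⟨hw₂0, hw₂1⟩ := prod3_weights (fun a : Fin n₂ => wt C.u₂ C.U a.val)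
    (fun a : Fin n₃ => wt C.u₃ C.U a.val) (fun a : Fin n₁ => wt C.u₁ C.U a.val)
    (fun a => wt_nonneg _ _ _) (fun a => wt_nonneg _ _ _) (fun a => wt_nonneg _ _ _)
    (sum_wt_le_one C.u₂ hUpos h2) (sum_wt_le_one C.u₃ hUpos h3) (sum_wt_le_one C.u₁ hUpos h1)
  obtain ⟨hw₃0, hw₃1⟩ := prod3_weights (fun a : Fin n₃ => wt C.u₃ C.U a.val)
    (fun a : Fin n₁ => wt C.u₁ C.U a.val) (fun a : Fin n₂ => wt C.u₂ C.U a.val)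
    (fun a => wt_nonneg _ _ _) (fun a => wt_nonneg _ _ _) (fun a => wt_nonneg _ _ _)
    (sum_wt_le_one C.u₃ hUpos h3) (sum_wt_le_one C.u₁ hUpos h1) (sum_wt_le_one C.u₂ hUpos h2)
  -- the floor θ = M / U³
  have hθ : (0 : ℝ) < C.M / (C.U : ℝ) ^ 3 := by positivity
  have hθ1 : (C.M : ℝ) / (C.U : ℝ) ^ 3 < 1 := by
    rw [div_lt_one hU3]; exact_mod_cast h5
  have hsupp : ∀ x y z, symm3 (cast K T) x y z ≠ 0 →
      ((C.M : ℝ) / (C.U : ℝ) ^ 3) ^ 3 ≤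
        (wt C.u₁ C.U x.1.val * (wt C.u₂ C.U x.2.1.val * wt C.u₃ C.U x.2.2.val)) *
        (wt C.u₂ C.U y.1.val * (wt C.u₃ C.U y.2.1.val * wt C.u₁ C.U y.2.2.val)) *
        (wt C.u₃ C.U z.1.val * (wt C.u₁ C.U z.2.1.val * wt C.u₂ C.U z.2.2.val)) := by
    intro x y z hne
    rw [symm3_apply] at hne
    have hA : T x.1 y.1 z.1 ≠ 0 := by
      intro h0; apply hne; simp [cast, h0]
    have hB : T z.2.1 x.2.1 y.2.1 ≠ 0 := by
      intro h0; apply hne; simp [cast, h0]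
    have hC : T y.2.2 z.2.2 x.2.2 ≠ 0 := by
      intro h0; apply hne; simp [cast, h0]
    have dP := block_le (U := C.U) hUpos (h6 _ _ _ hA)
    have dQ := block_le (U := C.U) hUpos (h6 _ _ _ hB)
    have dR := block_le (U := C.U) hUpos (h6 _ _ _ hC)
    have hθ0 : (0 : ℝ) ≤ C.M / (C.U : ℝ) ^ 3 := hθ.le
    have hP0 := hθ0.trans dP
    have hQ0 := hθ0.trans dQ
    calc ((C.M : ℝ) / (C.U : ℝ) ^ 3) ^ 3
        = (C.M : ℝ) / (C.U : ℝ) ^ 3 * ((C.M : ℝ) / (C.U : ℝ) ^ 3) * ((C.M : ℝ) / (C.U : ℝ) ^ 3) := by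
          ring
      _ ≤ (wt C.u₁ C.U x.1.val * wt C.u₂ C.U y.1.val * wt C.u₃ C.U z.1.val) *
            (wt C.u₁ C.U z.2.1.val * wt C.u₂ C.U x.2.1.val * wt C.u₃ C.U y.2.1.val) *
            (wt C.u₁ C.U y.2.2.val * wt C.u₂ C.U z.2.2.val * wt C.u₃ C.U x.2.2.val) :=
          mul_le_mul (mul_le_mul dP dQ hθ0 hP0) dR hθ0 (mul_nonneg hP0 hQ0)
      _ = _ := by ring
  -- a power of `sym T` restricts to `⟨2⟩`: already the first power
  have hw : TensorRestrictsTo (kroneckerPow (symm3 (cast K T)) 1) (unitTensor K 2) := by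
    have h1 : ∀ s : (Fin n₁ × Fin n₂ × Fin n₃) → (Fin n₂ × Fin n₃ × Fin n₁) → (Fin n₃ × Fin n₁ × Fin n₂) → K,
        TensorRestrictsTo (kroneckerPow s 1) s := fun s => by
      simpa [kroneckerPow_apply] using tensorRestrictsTo_precomp (kroneckerPow s 1)
        (fun (a : Fin n₁ × Fin n₂ × Fin n₃) (_ : Fin 1) => a)
        (fun (b : Fin n₂ × Fin n₃ × Fin n₁) (_ : Fin 1) => b)
        (fun (e : Fin n₃ × Fin n₁ × Fin n₂) (_ : Fin 1) => e)
    exact (h1 _).trans (restrictsTo_unitTensor_of_box T C h10)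
  have key := inv_logb_le_relativeExponent_of_weights (symm3 (cast K T))
    (fun x => wt C.u₁ C.U x.1.val * (wt C.u₂ C.U x.2.1.val * wt C.u₃ C.U x.2.2.val))
    (fun y => wt C.u₂ C.U y.1.val * (wt C.u₃ C.U y.2.1.val * wt C.u₁ C.U y.2.2.val))
    (fun z => wt C.u₃ C.U z.1.val * (wt C.u₁ C.U z.2.1.val * wt C.u₂ C.U z.2.2.val))
    hw₁0 hw₂0 hw₃0 hw₁1 hw₂1 hw₃1 hθ hθ1 hsupp hw
  rwa [one_div_div] at key

/-- `sym T` is not a triad (its flattening rank is `≥ 2`). [folklore] -/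
theorem symm3_ne_triad (T : Fin n₁ → Fin n₂ → Fin n₃ → ℤ) (C : Cert) {c d : ℕ}
    (h : check T C c d = true) : ∀ w u v, symm3 (cast K T) ≠ triad w u v := by
  obtain ⟨-, -, -, -, -, -, h7, h8, h9, -, h11, -, -⟩ := check_spec h
  intro w u v heq
  have hF : C.F₁ * C.F₂ * C.F₃ ≤ flatteningRank (symm3 (cast K T)) := by
    rw [flatteningRank_symm3, Nat.mul_assoc]
    exact Nat.mul_le_mul (le_flatteningRank_of_cert T h7)
      (Nat.mul_le_mul (le_flatteningRank_of_cert (rotate T) h8)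
        (le_flatteningRank_of_cert (rotate (rotate T)) h9))
  have h1 := flatteningRank_triad_le_one (K := K) w u v
  rw [← heq] at h1
  omega

/-- **Soundness, logarithmic form (CVZ Prop. 17 for `s = sym T`, certified):**
`2 log₂(F₁F₂F₃) / log₂(U³/M) ≤ 2·i(sym T)` over every field.
[cite: ChristandlVranaZuiddam2021, Prop. 17] -/
theorem logFloor_of_check (T : Fin n₁ → Fin n₂ → Fin n₃ → ℤ) (C : Cert) {c d : ℕ}
    (h : check T C c d = true) :
    2 * Real.logb 2 ((C.F₁ * C.F₂ * C.F₃ : ℕ) : ℝ) / Real.logb 2 ((C.U : ℝ) ^ 3 / C.M) ≤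
      2 * irreversibility (symm3 (cast K T)) := by
  obtain ⟨-, -, -, h4, h5, -, -, -, -, -, h11, -, -⟩ := check_spec h
  have hA := logb_le_relativeExponent_unit_symm3 (K := K) T C h
  have hB := inv_logb_le_relativeExponent_symm3_unit (K := K) T C h
  have hUpos : 0 < C.U := by
    rcases Nat.eq_zero_or_pos C.U with h0 | hp
    · rw [h0] at h5; simp at h5
    · exact hp
  have hU3 : (0 : ℝ) < (C.U : ℝ) ^ 3 := by positivity
  have hM : (0 : ℝ) < C.M := by exact_mod_cast h4
  have hratio : (1 : ℝ) < (C.U : ℝ) ^ 3 / C.M := by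
    rw [one_lt_div hM]; exact_mod_cast h5
  have hden : 0 < Real.logb 2 ((C.U : ℝ) ^ 3 / C.M) := Real.logb_pos one_lt_two hratio
  have hnum : 0 ≤ Real.logb 2 ((C.F₁ * C.F₂ * C.F₃ : ℕ) : ℝ) :=
    Real.logb_nonneg one_lt_two (by exact_mod_cast (by omega : 1 ≤ C.F₁ * C.F₂ * C.F₃))
  have key : Real.logb 2 ((C.F₁ * C.F₂ * C.F₃ : ℕ) : ℝ) * (1 / Real.logb 2 ((C.U : ℝ) ^ 3 / C.M)) ≤
      irreversibility (symm3 (cast K T)) := by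
    unfold irreversibility
    exact mul_le_mul hA hB (by positivity) (relativeExponent_nonneg _ _)
  calc 2 * Real.logb 2 ((C.F₁ * C.F₂ * C.F₃ : ℕ) : ℝ) / Real.logb 2 ((C.U : ℝ) ^ 3 / C.M)
      = 2 * (Real.logb 2 ((C.F₁ * C.F₂ * C.F₃ : ℕ) : ℝ) *
          (1 / Real.logb 2 ((C.U : ℝ) ^ 3 / C.M))) := by ring
    _ ≤ 2 * irreversibility (symm3 (cast K T)) := by linarith

/-- **Soundness, rational form:** `c/d ≤ 2·i(sym T)` over every field.
[cite: ChristandlVranaZuiddam2021, Prop. 17] -/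
theorem floor_of_check (T : Fin n₁ → Fin n₂ → Fin n₃ → ℤ) (C : Cert) {c d : ℕ}
    (h : check T C c d = true) : (c : ℝ) / d ≤ 2 * irreversibility (symm3 (cast K T)) := by
  obtain ⟨-, -, -, h4, h5, -, -, -, -, -, h11, h12, h13⟩ := check_spec h
  refine le_trans ?_ (logFloor_of_check (K := K) T C h)
  have hUpos : 0 < C.U := by
    rcases Nat.eq_zero_or_pos C.U with h0 | hp
    · rw [h0] at h5; simp at h5
    · exact hp
  have hU : (0 : ℝ) < C.U := by exact_mod_cast hUpos
  have hM : (0 : ℝ) < C.M := by exact_mod_cast h4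
  have hF : (0 : ℝ) < ((C.F₁ * C.F₂ * C.F₃ : ℕ) : ℝ) := by exact_mod_cast (by omega)
  have hd : (0 : ℝ) < d := by exact_mod_cast h12
  set LU := Real.logb 2 (C.U : ℝ) with hLU
  set LM := Real.logb 2 (C.M : ℝ) with hLM
  set LF := Real.logb 2 ((C.F₁ * C.F₂ * C.F₃ : ℕ) : ℝ) with hLF
  have hden_eq : Real.logb 2 ((C.U : ℝ) ^ 3 / C.M) = 3 * LU - LM := by
    rw [Real.logb_div (pow_ne_zero _ hU.ne') hM.ne', Real.logb_pow]
    push_cast; ring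
  have hratio : (1 : ℝ) < (C.U : ℝ) ^ 3 / C.M := by
    rw [one_lt_div hM]; exact_mod_cast h5
  have hden : 0 < 3 * LU - LM := by
    rw [← hden_eq]; exact Real.logb_pos one_lt_two hratio
  -- logarithm of the integer inequality (6)
  have hineq : ((C.U : ℝ)) ^ (3 * c) ≤ ((C.F₁ * C.F₂ * C.F₃ : ℕ) : ℝ) ^ (2 * d) * (C.M : ℝ) ^ c := by
    exact_mod_cast h13
  have hl := Real.logb_le_logb_of_le (b := 2) one_lt_two (by positivity) hineq
  rw [Real.logb_mul (by positivity) (by positivity), Real.logb_pow, Real.logb_pow,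
    Real.logb_pow, ← hLU, ← hLM, ← hLF] at hl
  push_cast at hl
  rw [hden_eq, div_le_div_iff₀ hd hden]
  nlinarith [hl]

/-- **The barrier (CVZ Thm. 9, certified instance):** no upper bound on `ω` below `c/d` can be
obtained through restrictions from powers of `sym T`:
`c/d ≤ 2·i(sym T) ≤ ω(⟨2⟩, sym T) · ω(sym T, ⟨2,2,2⟩)`. [cite: ChristandlVranaZuiddam2021, Thm. 9] -/
theorem barrier_of_check (T : Fin n₁ → Fin n₂ → Fin n₃ → ℤ) (C : Cert) {c d : ℕ}
    (h : check T C c d = true) :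
    (c : ℝ) / d ≤ relativeExponent (unitTensor K 2) (symm3 (cast K T)) *
      relativeExponent (symm3 (cast K T)) (matMulTensor K 2 2 2) :=
  (floor_of_check (K := K) T C h).trans
    (CVZ2021_thm9_holds K (symm3 (cast K T)) (symm3_ne_triad (K := K) T C h))

end Sound

/-! ## Worked example: Strassen's tensor `Str_2` -/

section Example

/-- Strassen's tensor `Str_2 = Σ_{i=1}^{2} (x_0 y_i z_i + x_i y_0 z_i)` as an integer `3 × 3 × 2`
array (third index `i − 1`). [cite: ChristandlVranaZuiddam2021, §1 (reduced polynomial multiplication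
and Strassen's tensor)] -/
def str2 : Fin 3 → Fin 3 → Fin 2 → ℤ :=
  ApproxCert.ofEntries 3 3 2 [((0, 1, 0), 1), ((0, 2, 1), 1), ((1, 0, 0), 1), ((2, 0, 1), 1)]

/-- Certificate for `Str_2`: weights `(2,1,1)/4`, `(2,1,1)/4`, `(2,2)/4` (the max-entropy dual
marginals), support floor `M = 4` (`U³/M = 16`: the tight value `Q̃(sym Str_2) = 2⁴`), flattening ranks
`3, 3, 2` (`ζ⁽¹⁾(sym Str_2) ≥ 18`), box `⟨2⟩ ≤ sym Str_2`, floor `c/d = 2084962/10⁶ ≤ 2·log₂ 18 / log₂ 16`.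
[cite: ChristandlVranaZuiddam2021, Prop. 17] -/
def str2Cert : Cert where
  u₁ := [2, 1, 1]
  u₂ := [2, 1, 1]
  u₃ := [2, 2]
  U := 4
  M := 4
  F₁ := 3
  F₂ := 3
  F₃ := 2
  rows₁ := [[(0, 1)], [(1, 1)], [(2, 1)]]
  piv₁ := [5, 0, 1]
  rows₂ := [[(0, 1)], [(1, 1)], [(2, 1)]]
  piv₂ := [5, 0, 3]
  rows₃ := [[(0, 1)], [(1, 1)]]
  piv₃ := [3, 6]
  x₀ := (0, 1, 0)
  x₁ := (1, 1, 0)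
  y₀ := (2, 0, 0)
  y₁ := (0, 0, 0)
  z₀ := (1, 0, 1)
  z₁ := (0, 0, 1)

/-- The certificate checks. [folklore] -/
theorem check_str2 : check str2 str2Cert 2084962 1000000 = true := by
  decide +kernel

/-- **`2·i(sym Str_2) ≥ 2.084962`** over every field (exact certificate value `2·log₂ 18 / log₂ 16 =
(log₂ 18)/2 ≈ 2.0849625`; CVZ Thm. 22 gives `2·i(Str_q)` in closed form for the tensor itself).
[cite: ChristandlVranaZuiddam2021, Prop. 17] -/
theorem floor_str2 (K : Type) [Field K] :
    (2084962 : ℝ) / 1000000 ≤ 2 * irreversibility (symm3 (cast K str2)) := by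
  simpa using floor_of_check (K := K) str2 str2Cert check_str2

/-- **No bound `ω < 2.084962` through powers of `sym Str_2`.** [cite: ChristandlVranaZuiddam2021, Thm. 9] -/
theorem barrier_str2 (K : Type) [Field K] :
    (2084962 : ℝ) / 1000000 ≤ relativeExponent (unitTensor K 2) (symm3 (cast K str2)) *
      relativeExponent (symm3 (cast K str2)) (matMulTensor K 2 2 2) := by
  simpa using barrier_of_check (K := K) str2 str2Cert check_str2

end Example

end IrrFloorCert

end Literature.Barriers.MatrixMultiplication
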